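import Summits.PneNP.PneNP.Theorems.SymmetryBudgetWindowBarrierEntropyGameRefinement
import Literature.Computability.Complexity.CircuitDAG
import Literature.Computability.Complexity.ThresholdGadgets

/-!
# Completeness of the entropy game, I: the coset-refinement circuit (the DAG)
(dichotomy `WindowBarrier` stmt-PneNP-2145 / `NoHiddenOrder` stmt-PneNP-14781, route `PneNP/SymmetryBudget`)

The canonical refinement `CosetGame.Rel K r A G β H γ` (`…EntropyGameRefinement.lean`) compiled into a
`Sym(Fin n)`-symmetric threshold circuit against a FIXED target graph `H`, in the style of the tree's
`k`-WL circuit `Literature.Computability.Complexity.SymWL.wlDAG` (Anderson–Dawar §3): gates are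
indexed by rounds, TYPES (`CosetGame.Ty n K`: the block groups of entropy `≤ K n`) and COSETS of the
type group on the input side (`P`, renamed by the symmetry action) and on the target side (`Q`, `D`,
never renamed); the existential bijections of the refinement are replaced by exact counts against the
target's classes (`…EntropyGameHall.lean`), realised by padded majorities.  Gate families:

* `tt`, `ff`, `ex u v` (`x(u,v) ∨ x(v,u)`, the symmetrised entry: the input matrix `x` is read as
  the graph `SimpleGraph.fromRel (x · · = true)`);
* `rel r A P Q` — "`Rel K r A (Gr x, P) (H, Q)`": the constant `true` at round `0`, at round
  `r + 1` the conjunction of `rel r A P Q`, of all block tests `beq r A P Q ⟨B, D⟩` and of all point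
  tests `peq A P Q q`;
* `bge / bgt / nbgt / beq r A P Q ⟨B, D⟩` — `#{ρ ∈ A | rel r B ⟦P.out ρ⟧ D}` is `≥ m`, `≥ m + 1`,
  not, `= m`, with `m = CosetGame.mB …` the target's own count;
* `pge / pgt / npgt / peq A P Q q` — `#{ρ ∈ A | (P.out ρ) q.1 ~ (P.out ρ) q.2 in Gr x} = mP …`;
* `out` — the disjunction over all pairs of one-block positions of `rel T ty₀ P Q`.

Here: index types and their finiteness, target counts, gate functions (all in `tcBasis`), wiring,
acyclicity, the DAG `CosetGame.crDAG`.  Symmetry, semantics and size: the next files.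
-/

-- `Summit.PneNP.PneNP.…` duplicates `PneNP` BY DESIGN (single-problem summit).
set_option linter.dupNamespace false

namespace Summit.PneNP.PneNP.Theorems

open Finset Literature.Computability.Complexity
open scoped Classical

namespace CosetGame

variable {n : ℕ}

noncomputable section

/-! ### Index types -/

/-- The types of the entropy-`K` game on `n` points, as a type. -/
def Ty (n K : ℕ) : Type := {A : Subgroup (Equiv.Perm (Fin n)) // IsType K A}

/-- There are finitely many types (subgroups of a finite group). -/
instance (n K : ℕ) : Finite (Ty n K) := by
  have : Finite (Subgroup (Equiv.Perm (Fin n))) :=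
    Finite.of_injective (fun A : Subgroup (Equiv.Perm (Fin n)) => (A : Set (Equiv.Perm (Fin n))))
      (fun _ _ h => SetLike.coe_injective h)
  exact Subtype.finite

/-- The (noncomputable) enumeration of the types. -/
instance (n K : ℕ) : Fintype (Ty n K) := Fintype.ofFinite _

/-- The positions of a type: left cosets of the type group. -/
abbrev Cos {K : ℕ} (A : Ty n K) : Type := Equiv.Perm (Fin n) ⧸ A.1

/-- The (noncomputable) enumeration of the positions of a type. -/
instance {K : ℕ} (A : Ty n K) : Fintype (Cos A) := Fintype.ofFinite _

/-- All (type, position) pairs. -/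
abbrev Pos (n K : ℕ) : Type := Σ A : Ty n K, Cos A

/-- The one-block type (block group of the constant labelling). -/
def ty₀ (n K : ℕ) : Ty n K := ⟨blockGroup fun _ : Fin n => 0, isType_blockGroup (isLowEntropy_const K)⟩

/-- The order of a type group. -/
abbrev cardA {K : ℕ} (A : Ty n K) : ℕ := Fintype.card A.1

/-- An enumeration of a type group. -/
def enumA {K : ℕ} (A : Ty n K) : Fin (cardA A) ≃ A.1 := (Fintype.equivFin A.1).symm

/-- An enumeration of all positions. -/
def enumPos (n K : ℕ) : Fin (Fintype.card (Pos n K)) ≃ Pos n K := (Fintype.equivFin (Pos n K)).symm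

/-- An enumeration of the pairs of one-block positions. -/
def enumOut (n K : ℕ) : Fin (Fintype.card (Cos (ty₀ n K) × Cos (ty₀ n K))) ≃ Cos (ty₀ n K) × Cos (ty₀ n K) :=
  (Fintype.equivFin _).symm

/-- The sub-position of type `B` reached from the position `P` through the group element number `i`. -/
def child {K : ℕ} {A : Ty n K} (P : Cos A) (B : Ty n K) (i : Fin (cardA A)) : Cos B :=
  QuotientGroup.mk (P.out * (enumA A i : Equiv.Perm (Fin n)))

/-! ### The target's counts -/

/-- Block count of the target: how many `ρ ∈ A` carry the `H`-position `Q` to a round-`r`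
equivalent of the `H`-position `D` of type `B`. -/
def mB (K : ℕ) (H : SimpleGraph (Fin n)) (r : ℕ) {A : Ty n K} (Q : Cos A) (B : Ty n K) (D : Cos B) : ℕ :=
  (univ.filter fun ρ : A.1 => Rel K r B.1 H (Q.out * ρ) H D.out).card

/-- Point count of the target: how many `ρ ∈ A` read an edge of `H` at the pair `q` through `Q`. -/
def mP {K : ℕ} (H : SimpleGraph (Fin n)) {A : Ty n K} (Q : Cos A) (q : Fin n × Fin n) : ℕ :=
  (univ.filter fun ρ : A.1 => H.Adj ((Q.out * ρ) q.1) ((Q.out * ρ) q.2)).card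

/-! ### Gates -/

set_option synthInstance.maxSize 4096 in
set_option synthInstance.maxHeartbeats 800000 in
/-- Gate indices of the coset-refinement circuit (see the module docstring). -/
inductive Node (n K T : ℕ) : Type
  | tt
  | ff
  | ex (u v : Fin n)
  | rel (r : Fin (T + 1)) (A : Ty n K) (P Q : Cos A)
  | bge (r : Fin T) (A : Ty n K) (P Q : Cos A) (BD : Pos n K)
  | bgt (r : Fin T) (A : Ty n K) (P Q : Cos A) (BD : Pos n K)
  | nbgt (r : Fin T) (A : Ty n K) (P Q : Cos A) (BD : Pos n K)
  | beq (r : Fin T) (A : Ty n K) (P Q : Cos A) (BD : Pos n K)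
  | pge (A : Ty n K) (P Q : Cos A) (q : Fin n × Fin n)
  | pgt (A : Ty n K) (P Q : Cos A) (q : Fin n × Fin n)
  | npgt (A : Ty n K) (P Q : Cos A) (q : Fin n × Fin n)
  | peq (A : Ty n K) (P Q : Cos A) (q : Fin n × Fin n)
  | out
  deriving Fintype

namespace Node

variable {K T : ℕ}

/-- Gate functions. -/
def fn : Node n K T → GateFn
  | tt => GateFn.and 0
  | ff => GateFn.or 0
  | ex _ _ => GateFn.or 2
  | rel ⟨0, _⟩ _ _ _ => GateFn.and 0
  | rel ⟨_ + 1, _⟩ _ _ _ => GateFn.and (1 + (Fintype.card (Pos n K) + n * n))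
  | bge _ A _ _ _ => GateFn.maj ((cardA A + 1) + (cardA A + 1))
  | bgt _ A _ _ _ => GateFn.maj ((cardA A + 1) + (cardA A + 1))
  | nbgt _ _ _ _ _ => GateFn.not
  | beq _ _ _ _ _ => GateFn.and 2
  | pge A _ _ _ => GateFn.maj ((cardA A + 1) + (cardA A + 1))
  | pgt A _ _ _ => GateFn.maj ((cardA A + 1) + (cardA A + 1))
  | npgt _ _ _ _ => GateFn.not
  | peq _ _ _ _ => GateFn.and 2
  | out => GateFn.or (Fintype.card (Cos (ty₀ n K) × Cos (ty₀ n K)))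

/-- Wires: matrix entries or gates. -/
abbrev W (n K T : ℕ) : Type := (Fin n × Fin n) ⊕ Node n K T

/-- The literal wire "`u ~ v` in the input graph": constant false on the diagonal, the symmetrised
entry otherwise. -/
def litW (u v : Fin n) : W n K T := if u = v then Sum.inr ff else Sum.inr (ex u v)

/-- The padding block of a threshold-`θ` counter of width `N + 1`. -/
def pad (N θ : ℕ) : Fin (N + 1) → W n K T :=
  fun j => if (j : ℕ) + θ < N + 1 then Sum.inr tt else Sum.inr ff

/-- Argument wires. -/
def args (H : SimpleGraph (Fin n)) : (l : Node n K T) → Fin (fn l).1 → W n K T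
  | tt => Fin.elim0
  | ff => Fin.elim0
  | ex u v => fun a => if (a : ℕ) = 0 then Sum.inl (u, v) else Sum.inl (v, u)
  | rel ⟨0, _⟩ _ _ _ => Fin.elim0
  | rel ⟨r + 1, h⟩ A P Q =>
      Fin.append (fun _ : Fin 1 => Sum.inr (rel ⟨r, by omega⟩ A P Q))
        (Fin.append (fun i => Sum.inr (beq ⟨r, by omega⟩ A P Q (enumPos n K i)))
          (fun i => Sum.inr (peq A P Q (finProdFinEquiv.symm i))))
  | bge r A P Q BD =>
      Fin.append (Fin.cons (Sum.inr ff) fun i => Sum.inr (rel r.castSucc BD.1 (child P BD.1 i) BD.2))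
        (pad (cardA A) (mB K H r Q BD.1 BD.2))
  | bgt r A P Q BD =>
      Fin.append (Fin.cons (Sum.inr ff) fun i => Sum.inr (rel r.castSucc BD.1 (child P BD.1 i) BD.2))
        (pad (cardA A) (mB K H r Q BD.1 BD.2 + 1))
  | nbgt r A P Q BD => fun _ => Sum.inr (bgt r A P Q BD)
  | beq r A P Q BD => fun a => if (a : ℕ) = 0 then Sum.inr (bge r A P Q BD) else Sum.inr (nbgt r A P Q BD)
  | pge A P Q q =>
      Fin.append (Fin.cons (Sum.inr ff) fun i =>
          litW ((P.out * (enumA A i : Equiv.Perm (Fin n))) q.1) ((P.out * (enumA A i : Equiv.Perm (Fin n))) q.2))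
        (pad (cardA A) (mP H Q q))
  | pgt A P Q q =>
      Fin.append (Fin.cons (Sum.inr ff) fun i =>
          litW ((P.out * (enumA A i : Equiv.Perm (Fin n))) q.1) ((P.out * (enumA A i : Equiv.Perm (Fin n))) q.2))
        (pad (cardA A) (mP H Q q + 1))
  | npgt A P Q q => fun _ => Sum.inr (pgt A P Q q)
  | peq A P Q q => fun a => if (a : ℕ) = 0 then Sum.inr (pge A P Q q) else Sum.inr (npgt A P Q q)
  | out => fun c => Sum.inr (rel (Fin.last T) (ty₀ n K) (enumOut n K c).1 (enumOut n K c).2)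

/-- A level function increasing along the wires (five levels per round; the point tests sit at
levels `1`–`3`, below every `rel` gate of positive round). -/
def level : Node n K T → ℕ
  | tt => 0
  | ff => 0
  | ex _ _ => 0
  | pge _ _ _ _ => 1
  | pgt _ _ _ _ => 1
  | npgt _ _ _ _ => 2
  | peq _ _ _ _ => 3
  | rel r _ _ _ => 5 * r + 4
  | bge r _ _ _ _ => 5 * r + 5
  | bgt r _ _ _ _ => 5 * r + 5
  | nbgt r _ _ _ _ => 5 * r + 6
  | beq r _ _ _ _ => 5 * r + 7
  | out => 5 * T + 5

/-- Literal wires point to gates of level `0`. -/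
theorem level_litW (u v : Fin n) (l : Node n K T) (h : (litW u v : W n K T) = Sum.inr l) : level l = 0 := by
  simp only [litW] at h
  split_ifs at h <;> cases h <;> rfl

/-- Padding wires point to constants. -/
theorem level_pad (N θ : ℕ) (j : Fin (N + 1)) (l : Node n K T) (h : (pad N θ j : W n K T) = Sum.inr l) :
    level l = 0 := by
  simp only [pad] at h
  split_ifs at h <;> cases h <;> rfl

/-- Wires of a padded counter point below level `L` as soon as the counted wires do (`0 < L`). -/
theorem level_lt_counter {N θ L : ℕ} (f : Fin N → W n K T)
    (hf : ∀ i l', f i = Sum.inr l' → level l' < L) (hL : 0 < L) (a : Fin ((N + 1) + (N + 1)))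
    (l' : Node n K T) (h : Fin.append (Fin.cons (Sum.inr ff) f) (pad N θ) a = Sum.inr l') :
    level l' < L := by
  induction a using Fin.addCases with
  | left i =>
    rw [Fin.append_left] at h
    revert h
    refine Fin.cases ?_ (fun w => ?_) i
    · intro h; simp only [Fin.cons_zero, Sum.inr.injEq] at h; subst h; exact hL
    · intro h; rw [Fin.cons_succ] at h; exact hf w l' h
  | right j =>
    rw [Fin.append_right] at h
    have := level_pad _ _ _ _ h
    omega

/-- Wires point to gates of smaller level (acyclicity). -/
theorem level_lt_of_args (H : SimpleGraph (Fin n)) {l l' : Node n K T} {a : Fin (fn l).1}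
    (h : args H l a = Sum.inr l') : level l' < level l := by
  cases l with
  | tt => exact a.elim0
  | ff => exact a.elim0
  | ex u v => (simp only [args] at h; split_ifs at h)
  | rel r A P Q =>
    rcases r with ⟨_ | r, hr⟩
    · exact a.elim0
    · change Fin (1 + (Fintype.card (Pos n K) + n * n)) at a
      simp only [args] at h
      induction a using Fin.addCases with
      | left i =>
        rw [Fin.append_left] at h
        cases h
        show 5 * r + 4 < 5 * (r + 1) + 4
        omega
      | right j =>
        rw [Fin.append_right] at h
        induction j using Fin.addCases with
        | left i =>
          rw [Fin.append_left] at h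
          cases h
          show 5 * r + 7 < 5 * (r + 1) + 4
          omega
        | right i =>
          rw [Fin.append_right] at h
          cases h
          show 3 < 5 * (r + 1) + 4
          omega
  | bge r A P Q BD =>
    exact level_lt_counter (L := 5 * (r : ℕ) + 5) _
      (fun w l₁ h₁ => by cases h₁; show 5 * (r : ℕ) + 4 < _; omega) (by omega) a l' h
  | bgt r A P Q BD =>
    exact level_lt_counter (L := 5 * (r : ℕ) + 5) _
      (fun w l₁ h₁ => by cases h₁; show 5 * (r : ℕ) + 4 < _; omega) (by omega) a l' h
  | nbgt r A P Q BD => simp only [args] at h; cases h; simp [level]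
  | beq r A P Q BD => simp only [args] at h; split_ifs at h <;> cases h <;> simp [level]
  | pge A P Q q =>
    exact level_lt_counter (L := 1) _
      (fun w l₁ h₁ => by have := level_litW _ _ _ h₁; omega) Nat.one_pos a l' h
  | pgt A P Q q =>
    exact level_lt_counter (L := 1) _
      (fun w l₁ h₁ => by have := level_litW _ _ _ h₁; omega) Nat.one_pos a l' h
  | npgt A P Q q => simp only [args] at h; cases h; simp [level]
  | peq A P Q q => simp only [args] at h; split_ifs at h <;> cases h <;> simp [level]
  | out => simp only [args] at h; cases h; simp [level]

/-- All gate functions lie in the threshold basis (`∧ₖ`, `∨ₖ`, `¬` are in `acBasis ⊆ tcBasis`,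
`MAJₖ ∈ tcBasis`). -/
theorem fn_mem_tcBasis (l : Node n K T) : fn l ∈ tcBasis := by
  have hand : ∀ k, GateFn.and k ∈ tcBasis := fun k =>
    acBasis_subset_tcBasis (Or.inr (Set.mem_iUnion.2 ⟨k, Or.inl rfl⟩))
  have hor : ∀ k, GateFn.or k ∈ tcBasis := fun k =>
    acBasis_subset_tcBasis (Or.inr (Set.mem_iUnion.2 ⟨k, Or.inr rfl⟩))
  cases l with
  | tt => exact hand 0
  | ff => exact hor 0
  | ex u v => exact hor 2
  | rel r A P Q =>
    rcases r with ⟨_ | r, hr⟩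
    · exact hand 0
    · exact hand _
  | bge _ A _ _ _ => exact maj_mem_tcBasis _
  | bgt _ A _ _ _ => exact maj_mem_tcBasis _
  | nbgt _ _ _ _ _ => exact not_mem_tcBasis
  | beq _ _ _ _ _ => exact hand 2
  | pge A _ _ _ => exact maj_mem_tcBasis _
  | pgt A _ _ _ => exact maj_mem_tcBasis _
  | npgt _ _ _ _ => exact not_mem_tcBasis
  | peq _ _ _ _ => exact hand 2
  | out => exact hor _

/-- All gate functions are symmetric Boolean functions. -/
theorem fn_isSymmetric (l : Node n K T) : (fn l).IsSymmetric :=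
  isSymmetric_of_mem_tcBasis (fn_mem_tcBasis l)

end Node

/-! ### The DAG -/

open Node

variable {K T : ℕ}

/-- **The coset-refinement circuit against the target `H`, as a DAG** on the gate type
`Node n K T` (rounds `0 … T`), with output the disjunction `out`. -/
def crDAG (K T : ℕ) (H : SimpleGraph (Fin n)) : GateDAG (Fin n × Fin n) (Node n K T) where
  fn := Node.fn
  args := Node.args H
  out := Sum.inr Node.out
  wf := Subrelation.wf (fun ⟨_, h⟩ => level_lt_of_args H h) (InvImage.wf level Nat.lt_wfRel.wf)

/-- The gate functions of the DAG. -/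
theorem crDAG_fn (H : SimpleGraph (Fin n)) (l : Node n K T) : (crDAG K T H).fn l = Node.fn l := rfl

/-- The wiring of the DAG. -/
theorem crDAG_args (H : SimpleGraph (Fin n)) (l : Node n K T) : (crDAG K T H).args l = Node.args H l := rfl

/-- The output of the DAG. -/
theorem crDAG_out (H : SimpleGraph (Fin n)) : (crDAG K T H).out = Sum.inr Node.out := rfl

/-- All gate functions lie in `tcBasis`. -/
theorem crDAG_fn_mem_tcBasis (H : SimpleGraph (Fin n)) (l : Node n K T) : (crDAG K T H).fn l ∈ tcBasis :=
  fn_mem_tcBasis l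

/-- All gate functions are symmetric. -/
theorem crDAG_fn_isSymmetric (H : SimpleGraph (Fin n)) (l : Node n K T) : ((crDAG K T H).fn l).IsSymmetric :=
  fn_isSymmetric l

end

end CosetGame

end Summit.PneNP.PneNP.Theorems
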